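import Mathlib
import HarnessLib

/-!
# Route `KLProgramme` — definitions: the weighted max-entry algebra of Cooper arrays and its s-wave blocks
# (carrier-agnostic vocabulary of the v2 Cooper clause (B1-v2)/(E2-v2) of crux K3's split)

Cell gate-hubbard-kl, seat p3 (Cooper-channel flow).  On a finite index set `S` (sector sites / lattice momenta of a scale ball)
with weights `w : S → ℝ` (`W = Σ w`): arrays `A : S → S → ℂ`, the weighted product `(A ∗_w B)(s,t) = Σ_u A(s,u) w_u B(u,t)` (`wmul`),
the all-ones array `J` (`onesArr`, the s-wave direction: `J ∗_w J = W·J`), the max-entry size `esup A = max |A(s,t)|` (p1's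
`|||A||| = W · esup A`), the weighted column / row AVERAGES `P_L A = W⁻¹ J ∗_w A`, `P_R A = W⁻¹ A ∗_w J` (`projL`, `projR`: commuting
idempotents), the four blocks `P_LP_R`, `P_LQ_R`, `Q_LP_R`, `Q_LQ_R` (`blockPP/PQ/QP/QQ`) and the block size `N(A) = Σ_blocks esup`
(`blockSize`; `esup ≤ N ≤ 9·esup`).  Theorems: `KLProgrammeSWaveCascadeAlgebra.lean` (the algebra), `KLProgrammeSWaveCascade.lean`
(the stability of the s-wave-dressed cascade = (E2-v2) at every step ⇒ (B1-v2)).  Definitions with bodies only.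
References: HOME/STATUS 2026-08-26 p1 g5 09:21:49Z ((B1-v2)/(E2-v2) design: `𝒞_n = U_n J + 𝒟_n` in the weighted max-entry norm),
plan g9 09:40:02Z (C-vi) / 10:04:09Z, p3 10:21:56Z (row 0′).
-/

noncomputable section

namespace Summit.HubbardSuperconductivity.HubbardSuperconductivity.Theorems.SWaveCascade

set_option linter.dupNamespace false -- summit = problem name (single-conjunct summit), D-0017

open Finset

variable {S : Type*} [Fintype S]

/-! ### The vocabulary -/

/-- The weighted product `(A ∗_w B)(s,t) = Σ_u A(s,u) · w_u · B(u,t)`. -/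
def wmul (w : S → ℝ) (A B : S → S → ℂ) : S → S → ℂ := fun s t => ∑ u, A s u * (w u : ℂ) * B u t

/-- The all-ones array `J` (the s-wave direction). -/
def onesArr : S → S → ℂ := fun _ _ => 1

/-- The max-entry size `esup A = max_{s,t} |A(s,t)|` (`0` on an empty carrier). -/
def esup (A : S → S → ℂ) : ℝ := sSup (Set.range fun p : S × S => ‖A p.1 p.2‖)

/-- The weighted column average `(P_L A)(s,t) = W⁻¹ Σ_u w_u A(u,t)` (independent of `s`; `= W⁻¹ J ∗_w A`). -/
def projL (w : S → ℝ) (A : S → S → ℂ) : S → S → ℂ := fun _ t => (∑ u, (w u : ℂ) * A u t) / ((∑ u, w u : ℝ) : ℂ)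

/-- The weighted row average `(P_R A)(s,t) = W⁻¹ Σ_u A(s,u) w_u` (independent of `t`; `= W⁻¹ A ∗_w J`). -/
def projR (w : S → ℝ) (A : S → S → ℂ) : S → S → ℂ := fun s _ => (∑ u, A s u * (w u : ℂ)) / ((∑ u, w u : ℝ) : ℂ)

/-- The `P_L P_R` block (s-wave ⊗ s-wave). -/
def blockPP (w : S → ℝ) (A : S → S → ℂ) : S → S → ℂ := projL w (projR w A)
/-- The `P_L Q_R` block. -/
def blockPQ (w : S → ℝ) (A : S → S → ℂ) : S → S → ℂ := projL w A - blockPP w A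
/-- The `Q_L P_R` block. -/
def blockQP (w : S → ℝ) (A : S → S → ℂ) : S → S → ℂ := projR w A - blockPP w A
/-- The `Q_L Q_R` block. -/
def blockQQ (w : S → ℝ) (A : S → S → ℂ) : S → S → ℂ := A - projL w A - projR w A + blockPP w A

/-- The block size `N(A) = Σ_{four blocks} esup`. -/
def blockSize (w : S → ℝ) (A : S → S → ℂ) : ℝ :=
  esup (blockPP w A) + esup (blockPQ w A) + esup (blockQP w A) + esup (blockQQ w A)


/-- **Restriction of an array to a finite set of indices** (the subtype carrier `↥B`; used to run the cascade on the
ultraviolet ball `klBall`, where the pair arrays are supported). -/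
def resArr (B : Finset S) (A : S → S → ℂ) : ↥B → ↥B → ℂ := fun k k' => A k.1 k'.1

end Summit.HubbardSuperconductivity.HubbardSuperconductivity.Theorems.SWaveCascade

end
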